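/-
Copyright (c) 2026. All rights reserved.
Released under Apache 2.0 license as described in the file LICENSE.

[NoBLE17] = Fitzner–van der Hofstad, "Generalized approach to the non-backtracking lace expansion",
Probab. Theory Relat. Fields 169 (2017) 1041–1119 (arXiv:1506.07969).  Page numbers below are PTRF pages.
-/
import Literature.Probability.FitznerVanDerHofstad2017.NobleLaplacianSplit
import Literature.Probability.FitznerVanDerHofstad2017.NobleCosineSplit
import HarnessLib

/-!
# Bounds on the key quantities of the `−Δ_k τ̂` split ([NoBLE17] §3.3.4 (3.40)–(3.51), §3.3.5 Steps 2–5)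

This module continues `NobleLaplacianSplit` (the derivative-free `k`-space identity
`−Δ τ̂_p(k) = Σ_{i=1}^5 Ĥ_i(k)` of [NoBLE17] (3.52)–(3.57), App. C).  It supplies the *bounds on the key
quantities* of [NoBLE17] §3.3.4, paragraph "Bounds on key quantities" ((3.44)–(3.51), PTRF pp. 1072–1073),
the gradient bounds (3.80)–(3.84) (p. 1078), and the resulting *pointwise* Fourier-space bounds on
`|Ĥ₂(k)|, |Ĥ₃(k)|, |Ĥ₄(k)|, |Ĥ₅(k)|` of §3.3.5 Steps 2–5 ((3.73), (3.76), Step 4, (3.85), pp. 1077–1079).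

Two levels, as in `NobleLaplacianSplit`:

* **atom level** (`namespace LapAtoms`): the bundle `LapAtoms.KeyBounds a r` records, for one `k` with
  `D̂(k) < 1`, the inequalities (3.40)/(3.44)–(3.49), (3.84) between the atoms of `a : LapAtoms` and the
  arguments `r : F3Bounds.Args` (`Γ₂′, c̄_Φ, α̲_F, ᾱ_F, β_{α,Φ}, β_{R,Φ}, β_{|ΔR,F|}, β_{ΔR,Φ}, K̲`) of the typed
  bound map `F3Bounds.boundH`.  From it we derive (3.43)ₖ, (3.46), (3.47), (3.50), (3.51) and the pointwise
  bounds on `|Ĥ_i(k)|`, `i = 2, …, 5`, in the polynomial shape of `F3Bounds.boundH2 … boundH5` with the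
  integrands `Ĉ(k)^m`, `Ĉ(k)^m |M̂*(k)|`, `Ĉ(k)^m D̂^{sin}(k)` in place of the tables `K, T*, U`
  (`Ĉ(k) = 1/(1 − D̂(k))`);
* **function level**: the Fourier-analytic inputs — `|R̂(k)| ≤ Σ|R|`, (3.48)
  `|R̂(0) − R̂(k)| ≤ [1 − D̂(k)] Σ‖x‖²|R(x)|` (total reflection symmetry, [NoBLE17] Lemma 2.12 / tree
  `tsum_mul_one_sub_cos_kdot_le`), (3.49) `|Δ R̂(k)| ≤ Σ‖x‖²|R(x)|`, the gradient bound (3.80)–(3.82)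
  `|∂_s R̂(k)| ≤ |sin k_s| Σ x_s² |R(x)|`, the isotropy (3.83) and the Cauchy–Schwarz-free form of (3.84) —
  and the theorem `keyBounds_lapAtomsAt` assembling `KeyBounds` for the atoms `lapAtomsAt d c_Φ α_Φ c_F α_F R_Φ R_F k`
  of a simplified rewrite with totally-reflection-symmetric remainders.

Remarks recorded for the referee (DIVERGENCE D75 of the b2b-lace audit): (i) the pointwise Step-4 bound
proved here is `|Ĥ₄(k)| ≤ K̲ Ĉ(k) (β_{ΔR,Φ} + β_{|ΔR,F|} Γ₂′ Ĉ(k))`; the printed Step 4 / (3.78) has one power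
of `Ĉ` less, which would need `1/[1 − F̂(k)] ≤ K̲` uniformly in `k`, and that is not available from (3.46)
near `k = 0`; (ii) the second summand of the `Ĥ₂` bound carries `β_{R,Φ}` (from `|R̂_Φ(k)| ≤ Σ|R_Φ|`), where the
printed (3.73)/(3.74) write `β_{ΔR,Φ}`.

No numeral and no dimension enters; every statement is either elementary real algebra ([folklore]) or the
transcription of the cited display.
-/

noncomputable section

namespace Literature.Probability.FitznerVanDerHofstad2017

open MeasureTheory Real Finset Filter
open scoped BigOperators
open Literature.Probability.LatticeModels
open Literature.Probability.Percolation
open Literature.Barriers.CriticalPhenomena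
open Literature.Probability.RandomPlanarGeometry.SAW.Zd (normSq normSq_nonneg)

variable {d : ℕ}

/-! ## Atom level -/

namespace LapAtoms

variable (a : LapAtoms)

/-- (3.44): `1 − F̂(k) = {1 − F̂(0) + α_F[1 − D̂(k)]} + {R̂_F(0) − R̂_F(k)}`, i.e. `Q = Cden + δ_{R,F}`.
[cite: FitznerVanDerHofstad2016NoBLE, §3.3.4 (3.44), PTRF p. 1072] -/
theorem Q_eq_Cden_add_δRF : a.Q = a.Cden + a.δRF := by
  simp only [Cden]; ring

/-- (3.62): `Ĝ = (c_Φ + α_Φ D̂) Ĉ* + (R̂_Φ − δ_{R,F} Ĝ) Ĉ*` (valid wherever both denominators are non-zero).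
[cite: FitznerVanDerHofstad2016NoBLE, §3.3.5 (3.62), PTRF p. 1075] -/
theorem G_eq_split (hQ : a.Q ≠ 0) (hC : a.Cden ≠ 0) :
    a.G = (a.cΦ + a.αΦ * a.D) * a.Cstar + (a.RΦ - a.δRF * a.G) * a.Cstar := by
  have hC' : a.Q - a.δRF ≠ 0 := by simpa [Cden] using hC
  simp only [G, Phi, Cstar, Cden]
  field_simp
  ring

/-- (3.65): `Ĝ² = Ĉ*² (c_Φ + α_Φ D̂)² + [R̂_Φ − δ_{R,F} Ĝ] Ĉ* [(c_Φ + α_Φ D̂) Ĉ* + Ĝ]`.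
[cite: FitznerVanDerHofstad2016NoBLE, §3.3.5 (3.65), PTRF p. 1075] -/
theorem G_sq_eq_split (hQ : a.Q ≠ 0) (hC : a.Cden ≠ 0) :
    a.G ^ 2 = a.Cstar ^ 2 * (a.cΦ + a.αΦ * a.D) ^ 2 +
      (a.RΦ - a.δRF * a.G) * a.Cstar * ((a.cΦ + a.αΦ * a.D) * a.Cstar + a.G) := by
  have h := a.G_eq_split hQ hC
  -- `G = A C* + B C*` with `A = c_Φ + α_Φ D̂`, `B = R̂_Φ − δ Ĝ`; then `G² − A²C*² − B C* (A C* + G) = (G + A C*)(G − A C* − B C*)`.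
  linear_combination (a.G + (a.cΦ + a.αΦ * a.D) * a.Cstar) * h

/-- **Key bounds at one `k`** ([NoBLE17] §3.3.4 "Bounds on key quantities", with the inputs of §3.3.5 Steps 2–5):
the inequalities between the atoms of the split and the arguments `r` of the bound map that hold at a point
`k` of the cube with `D̂(k) < 1` for a simplified rewrite whose remainders are totally reflection symmetric
(see `keyBounds_lapAtomsAt`).  `Q_ge` is (3.46) in the multiplicative form `1 − D̂ ≤ K̲ [1 − F̂(k)]`;
`Cden_ge` is (3.40)/(3.43); `δ_abs` is (3.48); `LΦ_abs`, `LF_abs` are (3.49); the `S…` fields are (3.84);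
`G_abs` is (3.47). [cite: FitznerVanDerHofstad2016NoBLE, §3.3.4 (3.40)–(3.49), PTRF pp. 1072–1073; §3.3.5 (3.84), p. 1078] -/
structure KeyBounds (r : F3Bounds.Args) : Prop where
  D_lt : a.D < 1
  absD : |a.D| ≤ 1
  Dsin_nn : 0 ≤ a.Dsin
  Q_pos : 0 < a.Q
  Q_ge : 1 - a.D ≤ r.Kunderline * a.Q
  K_nn : 0 ≤ r.Kunderline
  Cden_ge : a.αF * (1 - a.D) ≤ a.Cden
  afmin_pos : 0 < r.afmin
  αF_ge : r.afmin ≤ a.αF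
  αF_le : a.αF ≤ r.afmax
  δ_abs : |a.δRF| ≤ (1 - a.D) * r.bRfDelta
  cΦ_nn : 0 ≤ a.cΦ
  cΦ_le : a.cΦ ≤ r.cp
  αΦ_abs : |a.αΦ| ≤ r.ap
  RΦ_abs : |a.RΦ| ≤ r.bRp
  LΦ_abs : |a.LΦ| ≤ r.bRpDelta
  LF_abs : |a.LF| ≤ r.bRfDelta
  SDΦ_abs : |a.SDΦ| ≤ a.Dsin * r.bRpDelta
  SDF_abs : |a.SDF| ≤ a.Dsin * r.bRfDelta
  SΦF_abs : |a.SΦF| ≤ a.Dsin * r.bRpDelta * r.bRfDelta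
  SFF_abs : |a.SFF| ≤ a.Dsin * r.bRfDelta ^ 2
  G_abs : (1 - a.D) * |a.G| ≤ r.Gamma2dash

namespace KeyBounds

variable {a} {r : F3Bounds.Args} (h : a.KeyBounds r)
include h

/-- `0 < 1 − D̂(k)`. [folklore] -/
theorem one_sub_D_pos : 0 < 1 - a.D := sub_pos.2 h.D_lt

/-- `0 < Ĉ(k) = 1/(1 − D̂(k))`. [folklore] -/
theorem C_pos : 0 < 1 / (1 - a.D) := one_div_pos.2 h.one_sub_D_pos

/-- `0 < α_F`. [folklore] -/
theorem αF_pos : 0 < a.αF := h.afmin_pos.trans_le h.αF_ge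

/-- `0 < α_F [1 − D̂(k)] ≤ 1 − F̂(0) + α_F[1 − D̂(k)]` ((3.40): the denominator of `Ĉ*` is positive).
[cite: FitznerVanDerHofstad2016NoBLE, §3.3.4 (3.40), PTRF p. 1072] -/
theorem Cden_pos : 0 < a.Cden :=
  (mul_pos h.αF_pos h.one_sub_D_pos).trans_le h.Cden_ge

/-- `0 < Ĉ*(k)`. [folklore] -/
theorem Cstar_pos : 0 < a.Cstar := by
  rw [Cstar]; exact one_div_pos.2 h.Cden_pos

/-- `0 ≤ β_{|ΔR,F|}` (from (3.48) at a point with `D̂ < 1`). [folklore] -/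
theorem bRfDelta_nn : 0 ≤ r.bRfDelta :=
  nonneg_of_mul_nonneg_right ((abs_nonneg _).trans h.δ_abs) h.one_sub_D_pos

/-- `0 ≤ β_{ΔR,Φ}`. [folklore] -/
theorem bRpDelta_nn : 0 ≤ r.bRpDelta := (abs_nonneg _).trans h.LΦ_abs

/-- `0 ≤ β_{R,Φ}`. [folklore] -/
theorem bRp_nn : 0 ≤ r.bRp := (abs_nonneg _).trans h.RΦ_abs

/-- `0 ≤ β_{α,Φ}`. [folklore] -/
theorem ap_nn : 0 ≤ r.ap := (abs_nonneg _).trans h.αΦ_abs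

/-- `0 ≤ c̄_Φ`. [folklore] -/
theorem cp_nn : 0 ≤ r.cp := h.cΦ_nn.trans h.cΦ_le

/-- `0 ≤ Γ₂′` (from (3.47) at a point with `D̂ < 1`). [folklore] -/
theorem Gamma2dash_nn : 0 ≤ r.Gamma2dash :=
  (mul_nonneg h.one_sub_D_pos.le (abs_nonneg _)).trans h.G_abs

/-- (3.43) in `k`-space: `α_F Ĉ*(k) ≤ Ĉ(k)`. [cite: FitznerVanDerHofstad2016NoBLE, §3.3.4 (3.40)–(3.43), PTRF p. 1072] -/
theorem αF_mul_Cstar_le : a.αF * a.Cstar ≤ 1 / (1 - a.D) := by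
  rw [Cstar, mul_one_div, div_le_iff₀ h.Cden_pos, one_div_mul_eq_div, le_div_iff₀ h.one_sub_D_pos]
  exact h.Cden_ge

/-- (3.43) in `k`-space: `Ĉ*(k) ≤ Ĉ(k)/α̲_F`. [cite: FitznerVanDerHofstad2016NoBLE, §3.3.4 (3.43), PTRF p. 1072] -/
theorem Cstar_le : a.Cstar ≤ 1 / (1 - a.D) / r.afmin := by
  rw [le_div_iff₀ h.afmin_pos]
  calc a.Cstar * r.afmin ≤ a.Cstar * a.αF := mul_le_mul_of_nonneg_left h.αF_ge h.Cstar_pos.le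
    _ = a.αF * a.Cstar := mul_comm _ _
    _ ≤ 1 / (1 - a.D) := h.αF_mul_Cstar_le

/-- (3.46): `1/[1 − F̂(k)] ≤ K̲ Ĉ(k)`. [cite: FitznerVanDerHofstad2016NoBLE, §3.3.4 (3.46), PTRF p. 1072] -/
theorem inv_Q_le : 1 / a.Q ≤ r.Kunderline * (1 / (1 - a.D)) := by
  rw [mul_one_div, le_div_iff₀ h.one_sub_D_pos, one_div_mul_eq_div, div_le_iff₀ h.Q_pos]
  exact h.Q_ge

/-- `1/[1 − F̂(k)]² ≤ K̲² Ĉ(k)²`. [folklore] -/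
theorem inv_Q_sq_le : 1 / a.Q ^ 2 ≤ (r.Kunderline * (1 / (1 - a.D))) ^ 2 := by
  rw [← one_div_pow]
  exact pow_le_pow_left₀ (one_div_pos.2 h.Q_pos).le h.inv_Q_le 2

/-- (3.47): `|Ĝ(k)| ≤ Γ₂′ Ĉ(k)`. [cite: FitznerVanDerHofstad2016NoBLE, §3.3.4 (3.47), PTRF p. 1073] -/
theorem abs_G_le : |a.G| ≤ r.Gamma2dash * (1 / (1 - a.D)) := by
  rw [mul_one_div, le_div_iff₀ h.one_sub_D_pos, mul_comm]
  exact h.G_abs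

/-- `|δ_{R,F}(k)| / [1 − F̂(k)] ≤ β_{|ΔR,F|} K̲` ((3.46) with (3.48)).
[cite: FitznerVanDerHofstad2016NoBLE, §3.3.4 (3.46)–(3.48), PTRF pp. 1072–1073] -/
theorem abs_δRF_div_Q_le : |a.δRF| / a.Q ≤ r.bRfDelta * r.Kunderline := by
  rw [div_le_iff₀ h.Q_pos]
  calc |a.δRF| ≤ (1 - a.D) * r.bRfDelta := h.δ_abs
    _ ≤ r.Kunderline * a.Q * r.bRfDelta := mul_le_mul_of_nonneg_right h.Q_ge h.bRfDelta_nn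
    _ = r.bRfDelta * r.Kunderline * a.Q := by ring

/-- (3.50): `|Ê(k)| ≤ β_{|ΔR,F|} K̲ Ĉ*(k)`. [cite: FitznerVanDerHofstad2016NoBLE, §3.3.4 (3.50), PTRF p. 1073] -/
theorem abs_E_le : |a.E| ≤ r.bRfDelta * r.Kunderline * a.Cstar := by
  rw [E, abs_div, abs_mul, abs_of_pos h.Cstar_pos, abs_of_pos h.Q_pos, mul_div_right_comm]
  exact mul_le_mul_of_nonneg_right h.abs_δRF_div_Q_le h.Cstar_pos.le

/-- (3.50): `|Ê(k)| ≤ β_{|ΔR,F|} (K̲/α̲_F) Ĉ(k)`. [cite: FitznerVanDerHofstad2016NoBLE, §3.3.4 (3.50), PTRF p. 1073] -/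
theorem abs_E_le' : |a.E| ≤ r.bRfDelta * r.Kunderline / r.afmin * (1 / (1 - a.D)) :=
  h.abs_E_le.trans <| by
    rw [div_mul_eq_mul_div, mul_div_assoc]
    exact mul_le_mul_of_nonneg_left h.Cstar_le (mul_nonneg h.bRfDelta_nn h.K_nn)

/-- (3.51), numerator: `|R̂_Φ(k) − δ_{R,F}(k) Ĝ(k)| ≤ β_{R,Φ} + β_{|ΔR,F|} Γ₂′`.
[cite: FitznerVanDerHofstad2016NoBLE, §3.3.4 (3.51), PTRF p. 1073] -/
theorem abs_RΦ_sub_δG_le : |a.RΦ - a.δRF * a.G| ≤ r.bRp + r.bRfDelta * r.Gamma2dash := by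
  refine (abs_sub _ _).trans (add_le_add h.RΦ_abs ?_)
  rw [abs_mul]
  calc |a.δRF| * |a.G| ≤ (1 - a.D) * r.bRfDelta * |a.G| := mul_le_mul_of_nonneg_right h.δ_abs (abs_nonneg _)
    _ = r.bRfDelta * ((1 - a.D) * |a.G|) := by ring
    _ ≤ r.bRfDelta * r.Gamma2dash := mul_le_mul_of_nonneg_left h.G_abs h.bRfDelta_nn

/-- (3.51): `|R̂_Φ(k) − δ_{R,F}(k) Ĝ(k)| Ĉ*(k) ≤ ((β_{R,Φ} + β_{|ΔR,F|} Γ₂′)/α̲_F) Ĉ(k)`.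
[cite: FitznerVanDerHofstad2016NoBLE, §3.3.4 (3.51), PTRF p. 1073] -/
theorem abs_RΦ_sub_δG_mul_Cstar_le :
    |(a.RΦ - a.δRF * a.G) * a.Cstar| ≤ (r.bRp + r.bRfDelta * r.Gamma2dash) / r.afmin * (1 / (1 - a.D)) := by
  rw [abs_mul, abs_of_pos h.Cstar_pos, div_mul_eq_mul_div, mul_div_assoc]
  exact mul_le_mul h.abs_RΦ_sub_δG_le h.Cstar_le h.Cstar_pos.le
    (add_nonneg h.bRp_nn (mul_nonneg h.bRfDelta_nn h.Gamma2dash_nn))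

/-- `|α_F − 1| ≤ max |α̲_F − 1| |ᾱ_F − 1|` (= `F3Bounds.m3`). [folklore] -/
theorem abs_αF_sub_one_le : |a.αF - 1| ≤ F3Bounds.m3 r := by
  rw [F3Bounds.m3]
  rcases le_total 1 a.αF with h1 | h1
  · rw [abs_of_nonneg (sub_nonneg.2 h1)]
    exact le_max_of_le_right ((sub_le_sub_right h.αF_le 1).trans (le_abs_self _))
  · rw [abs_of_nonpos (sub_nonpos.2 h1)]
    refine le_max_of_le_left ?_
    calc -(a.αF - 1) = 1 - a.αF := by ring
      _ ≤ 1 - r.afmin := sub_le_sub_left h.αF_ge 1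
      _ ≤ |r.afmin - 1| := by rw [abs_sub_comm]; exact le_abs_self _

/-- `|c_Φ + α_Φ D̂(k)| ≤ c̄_Φ + β_{α,Φ} |D̂(k)|`. [folklore] -/
theorem abs_cΦ_add_le : |a.cΦ + a.αΦ * a.D| ≤ r.cp + r.ap * |a.D| := by
  refine (abs_add_le _ _).trans (add_le_add ?_ ?_)
  · rw [abs_of_nonneg h.cΦ_nn]; exact h.cΦ_le
  · rw [abs_mul]; exact mul_le_mul_of_nonneg_right h.αΦ_abs (abs_nonneg _)

/-- `|α_F Ĝ(k) + α_Φ| ≤ α_F Γ₂′ Ĉ(k) + β_{α,Φ}`. [folklore] -/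
theorem abs_αF_G_add_le : |a.αF * a.G + a.αΦ| ≤ a.αF * (r.Gamma2dash * (1 / (1 - a.D))) + r.ap := by
  refine (abs_add_le _ _).trans (add_le_add ?_ h.αΦ_abs)
  rw [abs_mul, abs_of_pos h.αF_pos]
  exact mul_le_mul_of_nonneg_left h.abs_G_le h.αF_pos.le

/-- **Step 2, pointwise** ((3.73) with the natural slot `β_{R,Φ}` for `|R̂_Φ(k)|`):
`|Ĥ₂(k)| ≤ β_{|ΔR,F|} K̲ [(c̄_Φ + β_{α,Φ}|D̂|)(1/α̲_F + K̲) Ĉ² + (β_{α,Φ}/α̲_F) Ĉ] |M̂*| + ᾱ_F β_{R,Φ} K̲² Ĉ² |M̂*|`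
(`Ĉ = Ĉ(k) = 1/(1 − D̂(k))`).  Integrated against `|D̂|^l |D̂^{(x)}|` this is the shape of `F3Bounds.boundH2`
(tables `T*_{2,l}, T*_{2,l+1}, T*_{1,l}`). [cite: FitznerVanDerHofstad2016NoBLE, §3.3.5 (3.72)–(3.74), PTRF p. 1077] -/
theorem abs_H2_le :
    |a.H2| ≤ r.bRfDelta * r.Kunderline *
        ((r.cp + r.ap * |a.D|) * (1 / r.afmin + r.Kunderline) * (1 / (1 - a.D)) ^ 2 +
          r.ap / r.afmin * (1 / (1 - a.D))) * |a.Mstar| +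
      r.afmax * r.bRp * r.Kunderline ^ 2 * (1 / (1 - a.D)) ^ 2 * |a.Mstar| := by
  set C := 1 / (1 - a.D) with hCdef
  set K := r.Kunderline with hKdef
  set A := r.cp + r.ap * |a.D| with hAdef
  have hC : 0 < C := h.C_pos
  have hK : 0 ≤ K := h.K_nn
  have hA : 0 ≤ A := add_nonneg h.cp_nn (mul_nonneg h.ap_nn (abs_nonneg _))
  have hQ : 0 < a.Q := h.Q_pos
  have hCs : 0 < a.Cstar := h.Cstar_pos
  have hαF : 0 < a.αF := h.αF_pos
  have hbF : 0 ≤ r.bRfDelta := h.bRfDelta_nn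
  have hap : 0 ≤ r.ap := h.ap_nn
  have hM : 0 ≤ |a.Mstar| := abs_nonneg _
  -- the first summand `X Ê M̂*` with `X = α_F (c_Φ + α_Φ D̂)(Ĉ* + 1/Q) + α_Φ`
  set X := a.αF * (a.cΦ + a.αΦ * a.D) * (a.Cstar + 1 / a.Q) + a.αΦ with hXdef
  have hX : |X| ≤ a.αF * A * (a.Cstar + 1 / a.Q) + r.ap := by
    refine (abs_add_le _ _).trans (add_le_add ?_ h.αΦ_abs)
    rw [abs_mul, abs_mul, abs_of_pos hαF, abs_of_pos (add_pos hCs (one_div_pos.2 hQ))]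
    exact mul_le_mul_of_nonneg_right (mul_le_mul_of_nonneg_left h.abs_cΦ_add_le hαF.le) (by positivity)
  have hH2 : a.H2 = -(X * a.E * a.Mstar) + a.αF * (a.RΦ / a.Q ^ 2) * a.Mstar := by
    simp only [H2, hXdef]
  -- bound the two summands
  have h1 : |X * a.E * a.Mstar| ≤ (a.αF * A * (a.Cstar + 1 / a.Q) + r.ap) * (r.bRfDelta * K * a.Cstar) * |a.Mstar| := by
    rw [abs_mul, abs_mul]
    exact mul_le_mul_of_nonneg_right (mul_le_mul hX h.abs_E_le (abs_nonneg _) (by positivity)) hM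
  have h2 : |a.αF * (a.RΦ / a.Q ^ 2) * a.Mstar| ≤ r.afmax * r.bRp * (K * C) ^ 2 * |a.Mstar| := by
    rw [abs_mul, abs_mul, abs_of_pos hαF, abs_div, abs_of_pos (pow_pos hQ 2), div_eq_mul_one_div |a.RΦ| (a.Q ^ 2)]
    refine mul_le_mul_of_nonneg_right ?_ hM
    rw [mul_assoc (r.afmax)]
    exact mul_le_mul h.αF_le (mul_le_mul h.RΦ_abs h.inv_Q_sq_le (by positivity) h.bRp_nn)
      (by positivity) (hαF.le.trans h.αF_le)
  -- the three elementary comparisons `α_F Ĉ* Ĉ* ≤ Ĉ Ĉ/α̲_F`, `α_F Ĉ* /Q ≤ Ĉ K̲ Ĉ`, `Ĉ* ≤ Ĉ/α̲_F`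
  have t1 : a.αF * a.Cstar * a.Cstar ≤ C * (C / r.afmin) :=
    mul_le_mul h.αF_mul_Cstar_le h.Cstar_le hCs.le hC.le
  have t2 : a.αF * a.Cstar * (1 / a.Q) ≤ C * (K * C) :=
    mul_le_mul h.αF_mul_Cstar_le h.inv_Q_le (by positivity) hC.le
  have t3 : a.Cstar ≤ C / r.afmin := h.Cstar_le
  have s1 := mul_le_mul_of_nonneg_left t1 (mul_nonneg (mul_nonneg hA hbF) hK)
  have s2 := mul_le_mul_of_nonneg_left t2 (mul_nonneg (mul_nonneg hA hbF) hK)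
  have s3 := mul_le_mul_of_nonneg_left t3 (mul_nonneg (mul_nonneg h.ap_nn hbF) hK)
  have key : (a.αF * A * (a.Cstar + 1 / a.Q) + r.ap) * (r.bRfDelta * K * a.Cstar) ≤
      r.bRfDelta * K * (A * (1 / r.afmin + K) * C ^ 2 + r.ap / r.afmin * C) := by
    have e1 : (a.αF * A * (a.Cstar + 1 / a.Q) + r.ap) * (r.bRfDelta * K * a.Cstar) =
        A * r.bRfDelta * K * (a.αF * a.Cstar * a.Cstar) + A * r.bRfDelta * K * (a.αF * a.Cstar * (1 / a.Q)) +
          r.ap * r.bRfDelta * K * a.Cstar := by ring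
    have e2 : r.bRfDelta * K * (A * (1 / r.afmin + K) * C ^ 2 + r.ap / r.afmin * C) =
        A * r.bRfDelta * K * (C * (C / r.afmin)) + A * r.bRfDelta * K * (C * (K * C)) +
          r.ap * r.bRfDelta * K * (C / r.afmin) := by ring
    rw [e1, e2]; linarith
  calc |a.H2| = |-(X * a.E * a.Mstar) + a.αF * (a.RΦ / a.Q ^ 2) * a.Mstar| := by rw [hH2]
    _ ≤ |X * a.E * a.Mstar| + |a.αF * (a.RΦ / a.Q ^ 2) * a.Mstar| := by
        refine (abs_add_le _ _).trans ?_; rw [abs_neg]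
    _ ≤ (a.αF * A * (a.Cstar + 1 / a.Q) + r.ap) * (r.bRfDelta * K * a.Cstar) * |a.Mstar| +
          r.afmax * r.bRp * (K * C) ^ 2 * |a.Mstar| := add_le_add h1 h2
    _ ≤ r.bRfDelta * K * (A * (1 / r.afmin + K) * C ^ 2 + r.ap / r.afmin * C) * |a.Mstar| +
          r.afmax * r.bRp * (K * C) ^ 2 * |a.Mstar| :=
        add_le_add (mul_le_mul_of_nonneg_right key hM) le_rfl
    _ = _ := by ring

/-- `Ĉ*(k) ≤ Ĉ(k)/α_F` ((3.43) in `k`-space, with the actual `α_F`). [cite: FitznerVanDerHofstad2016NoBLE, §3.3.4 (3.43), PTRF p. 1072] -/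
theorem Cstar_le_div_αF : a.Cstar ≤ 1 / (1 - a.D) / a.αF := by
  rw [le_div_iff₀ h.αF_pos, mul_comm]; exact h.αF_mul_Cstar_le

/-- `|M̂*(k)| ≤ |D̂(k)| + 2 D̂^{sin}(k) Ĉ*(k)` (`M̂* = D̂ − 2 D̂^{sin} Ĉ*`, the `Ĉ*`-analogue of `M̂` in (3.37)/(3.72)).
[cite: FitznerVanDerHofstad2016NoBLE, §3.3.4 (3.53) and §3.3.5 (3.72), PTRF pp. 1073, 1077] -/
theorem abs_Mstar_le : |a.Mstar| ≤ |a.D| + 2 * a.Dsin * a.Cstar := by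
  rw [Mstar]
  refine (abs_sub _ _).trans (add_le_add le_rfl (le_of_eq ?_))
  rw [abs_mul, abs_mul, abs_two, abs_of_nonneg h.Dsin_nn, abs_of_pos h.Cstar_pos]

/-- `|M̂*(k)| ≤ |D̂(k)| + 2 D̂^{sin}(k) Ĉ(k)/α̲_F` — so `T*_{n,l}` is dominated by the `T`-type integrand with `Ĉ/α̲_F`
in place of `Ĉ` inside `M̂` ("we bound `T*_{n,l}` in the same way as `T_{n,l}`", §3.3.5 after (3.72)).
[cite: FitznerVanDerHofstad2016NoBLE, §3.3.5 (3.72) and the sentence following it, PTRF p. 1077] -/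
theorem abs_Mstar_le' : |a.Mstar| ≤ |a.D| + 2 * a.Dsin * (1 / (1 - a.D) / r.afmin) :=
  h.abs_Mstar_le.trans
    (add_le_add le_rfl (mul_le_mul_of_nonneg_left h.Cstar_le (mul_nonneg two_pos.le h.Dsin_nn)))

/-- **Step 3, pointwise** ((3.76)): `|Ĥ₃(k)| ≤ 2 D̂^{sin} K̲² Ĉ² (α_F Γ₂′ Ĉ + β_{α,Φ})(β_{|ΔR,F|}/α_F + |α_F − 1|)`.
[cite: FitznerVanDerHofstad2016NoBLE, §3.3.5 (3.75)–(3.76), PTRF p. 1077] -/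
theorem abs_H3_le_raw :
    |a.H3| ≤ 2 * a.Dsin * (r.Kunderline * (1 / (1 - a.D))) ^ 2 *
      (a.αF * (r.Gamma2dash * (1 / (1 - a.D))) + r.ap) * (r.bRfDelta / a.αF + |a.αF - 1|) := by
  set C := 1 / (1 - a.D) with hCdef
  set K := r.Kunderline with hKdef
  have hC : 0 < C := h.C_pos
  have hK : 0 ≤ K := h.K_nn
  have hQ : 0 < a.Q := h.Q_pos
  have hbF : 0 ≤ r.bRfDelta := h.bRfDelta_nn
  have hDs : 0 ≤ a.Dsin := h.Dsin_nn
  have hαF : 0 < a.αF := h.αF_pos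
  have hΓ : 0 ≤ r.Gamma2dash := h.Gamma2dash_nn
  have hap : 0 ≤ r.ap := h.ap_nn
  have hE : |a.E - (a.αF - 1) / a.Q| ≤ K * C * (r.bRfDelta / a.αF + |a.αF - 1|) := by
    refine (abs_sub _ _).trans ?_
    have e1 : |a.E| ≤ r.bRfDelta * K * (C / a.αF) :=
      h.abs_E_le.trans (mul_le_mul_of_nonneg_left h.Cstar_le_div_αF (mul_nonneg hbF hK))
    have e2 : |(a.αF - 1) / a.Q| ≤ |a.αF - 1| * (K * C) := by
      rw [abs_div, abs_of_pos hQ, div_eq_mul_one_div]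
      exact mul_le_mul_of_nonneg_left h.inv_Q_le (abs_nonneg _)
    calc |a.E| + |(a.αF - 1) / a.Q| ≤ r.bRfDelta * K * (C / a.αF) + |a.αF - 1| * (K * C) := add_le_add e1 e2
      _ = K * C * (r.bRfDelta / a.αF + |a.αF - 1|) := by ring
  have hH3 : |a.H3| = 2 * (a.Dsin * (1 / a.Q)) * |a.αF * a.G + a.αΦ| * |a.E - (a.αF - 1) / a.Q| := by
    rw [H3, abs_mul, abs_mul, abs_mul, abs_two, abs_of_nonneg (div_nonneg hDs hQ.le),
      div_eq_mul_one_div a.Dsin a.Q]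
  rw [hH3]
  have i1 : 2 * (a.Dsin * (1 / a.Q)) ≤ 2 * (a.Dsin * (K * C)) :=
    mul_le_mul_of_nonneg_left (mul_le_mul_of_nonneg_left h.inv_Q_le hDs) two_pos.le
  have i2 := h.abs_αF_G_add_le
  have n1 : 0 ≤ a.αF * (r.Gamma2dash * C) + r.ap := by positivity
  have n2 : 0 ≤ 2 * (a.Dsin * (K * C)) := by positivity
  calc 2 * (a.Dsin * (1 / a.Q)) * |a.αF * a.G + a.αΦ| * |a.E - (a.αF - 1) / a.Q|
      ≤ 2 * (a.Dsin * (K * C)) * (a.αF * (r.Gamma2dash * C) + r.ap) * (K * C * (r.bRfDelta / a.αF + |a.αF - 1|)) :=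
        mul_le_mul (mul_le_mul i1 i2 (abs_nonneg _) n2) hE (abs_nonneg _) (mul_nonneg n2 n1)
    _ = _ := by ring

/-- **Step 3, pointwise, table shape** ((3.76) → the (3.77) integrand, using `α_F ≤ ᾱ_F`, `1/α_F ≤ 1/α̲_F`,
`|α_F − 1| ≤ m₃`): `|Ĥ₃(k)| ≤ 2K̲² β_{α,Φ} (β_{|ΔR,F|}/α̲_F + m₃) D̂^{sin} Ĉ² + 2K̲² Γ₂′ (ᾱ_F m₃ + β_{|ΔR,F|}) D̂^{sin} Ĉ³`
— the shape of `F3Bounds.boundH3` (tables `U_{2,l}, U_{3,l}`).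
[cite: FitznerVanDerHofstad2016NoBLE, §3.3.5 (3.76)–(3.77), PTRF p. 1077] -/
theorem abs_H3_le :
    |a.H3| ≤ 2 * r.Kunderline ^ 2 * r.ap * (r.bRfDelta / r.afmin + F3Bounds.m3 r) *
        (a.Dsin * (1 / (1 - a.D)) ^ 2) +
      2 * r.Kunderline ^ 2 * r.Gamma2dash * (r.afmax * F3Bounds.m3 r + r.bRfDelta) *
        (a.Dsin * (1 / (1 - a.D)) ^ 3) := by
  set C := 1 / (1 - a.D) with hCdef
  set K := r.Kunderline with hKdef
  have hC : 0 < C := h.C_pos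
  have hK : 0 ≤ K := h.K_nn
  have hbF : 0 ≤ r.bRfDelta := h.bRfDelta_nn
  have hDs : 0 ≤ a.Dsin := h.Dsin_nn
  have hαF : 0 < a.αF := h.αF_pos
  have hΓ : 0 ≤ r.Gamma2dash := h.Gamma2dash_nn
  have hap : 0 ≤ r.ap := h.ap_nn
  have hm3 : |a.αF - 1| ≤ F3Bounds.m3 r := h.abs_αF_sub_one_le
  refine h.abs_H3_le_raw.trans ?_
  have e : a.αF * (r.bRfDelta / a.αF) = r.bRfDelta := by field_simp
  have i1 : (a.αF * (r.Gamma2dash * C) + r.ap) * (r.bRfDelta / a.αF + |a.αF - 1|) =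
      r.Gamma2dash * C * r.bRfDelta + r.Gamma2dash * C * (a.αF * |a.αF - 1|) +
        r.ap * (r.bRfDelta / a.αF) + r.ap * |a.αF - 1| := by
    calc _ = r.Gamma2dash * C * (a.αF * (r.bRfDelta / a.αF)) + r.Gamma2dash * C * (a.αF * |a.αF - 1|) +
          r.ap * (r.bRfDelta / a.αF) + r.ap * |a.αF - 1| := by ring
      _ = _ := by rw [e]
  have t1 : a.αF * |a.αF - 1| ≤ r.afmax * F3Bounds.m3 r :=
    mul_le_mul h.αF_le hm3 (abs_nonneg _) (hαF.le.trans h.αF_le)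
  have t2 : r.bRfDelta / a.αF ≤ r.bRfDelta / r.afmin :=
    div_le_div_of_nonneg_left hbF h.afmin_pos h.αF_ge
  have i2 : r.Gamma2dash * C * r.bRfDelta + r.Gamma2dash * C * (a.αF * |a.αF - 1|) +
        r.ap * (r.bRfDelta / a.αF) + r.ap * |a.αF - 1| ≤
      r.Gamma2dash * C * r.bRfDelta + r.Gamma2dash * C * (r.afmax * F3Bounds.m3 r) +
        r.ap * (r.bRfDelta / r.afmin) + r.ap * F3Bounds.m3 r :=
    add_le_add (add_le_add (add_le_add le_rfl (mul_le_mul_of_nonneg_left t1 (mul_nonneg hΓ hC.le)))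
      (mul_le_mul_of_nonneg_left t2 hap)) (mul_le_mul_of_nonneg_left hm3 hap)
  have n0 : 0 ≤ 2 * a.Dsin * (K * C) ^ 2 := by positivity
  calc 2 * a.Dsin * (K * C) ^ 2 * (a.αF * (r.Gamma2dash * C) + r.ap) * (r.bRfDelta / a.αF + |a.αF - 1|)
      = 2 * a.Dsin * (K * C) ^ 2 * ((a.αF * (r.Gamma2dash * C) + r.ap) * (r.bRfDelta / a.αF + |a.αF - 1|)) := by
        ring
    _ ≤ 2 * a.Dsin * (K * C) ^ 2 * (r.Gamma2dash * C * r.bRfDelta + r.Gamma2dash * C * (r.afmax * F3Bounds.m3 r) +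
        r.ap * (r.bRfDelta / r.afmin) + r.ap * F3Bounds.m3 r) := by
        rw [i1]; exact mul_le_mul_of_nonneg_left i2 n0
    _ = _ := by ring

/-- **Step 4, pointwise** (corrected form, see the module docstring): `|Ĥ₄(k)| ≤ K̲ Ĉ (β_{ΔR,Φ} + β_{|ΔR,F|} Γ₂′ Ĉ)`
from `Ĥ₄ = Δ R̂_Φ/[1 − F̂] + (Δ R̂_F/[1 − F̂]) Ĝ`, (3.46), (3.47), (3.49).
[cite: FitznerVanDerHofstad2016NoBLE, §3.3.5 Step 4, PTRF p. 1078; §3.3.4 (3.46)–(3.49), pp. 1072–1073] -/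
theorem abs_H4_le :
    |a.H4| ≤ r.Kunderline * (r.bRpDelta * (1 / (1 - a.D)) + r.bRfDelta * r.Gamma2dash * (1 / (1 - a.D)) ^ 2) := by
  set C := 1 / (1 - a.D) with hCdef
  set K := r.Kunderline with hKdef
  have hC : 0 < C := h.C_pos
  have hK : 0 ≤ K := h.K_nn
  have hQ : 0 < a.Q := h.Q_pos
  have hbF : 0 ≤ r.bRfDelta := h.bRfDelta_nn
  have hbΦ : 0 ≤ r.bRpDelta := h.bRpDelta_nn
  have hΓ : 0 ≤ r.Gamma2dash := h.Gamma2dash_nn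
  have hq : 0 < 1 / a.Q := one_div_pos.2 hQ
  have hH4 : |a.H4| ≤ |a.LΦ| * (1 / a.Q) + |a.LF| * (1 / a.Q) * |a.G| := by
    rw [H4, div_eq_mul_one_div a.LΦ a.Q, div_eq_mul_one_div a.LF a.Q]
    refine (abs_add_le _ _).trans (le_of_eq ?_)
    rw [abs_mul, abs_mul, abs_mul, abs_of_pos hq]
  refine hH4.trans ?_
  calc |a.LΦ| * (1 / a.Q) + |a.LF| * (1 / a.Q) * |a.G|
      ≤ r.bRpDelta * (K * C) + r.bRfDelta * (K * C) * (r.Gamma2dash * C) :=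
        add_le_add (mul_le_mul h.LΦ_abs h.inv_Q_le (by positivity) hbΦ)
          (mul_le_mul (mul_le_mul h.LF_abs h.inv_Q_le (by positivity) hbF) h.abs_G_le (abs_nonneg _)
            (by positivity))
    _ = _ := by ring

/-- **Step 5, pointwise** ((3.85) with `n = 0`, using `α_F ≤ ᾱ_F`):
`|Ĥ₅(k)| ≤ 2K̲² Γ₂′ (2ᾱ_F β_{|ΔR,F|} + β_{|ΔR,F|}²) D̂^{sin} Ĉ³ + 2K̲² (ᾱ_F β_{ΔR,Φ} + (β_{α,Φ} + β_{ΔR,Φ}) β_{|ΔR,F|}) D̂^{sin} Ĉ²`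
— the shape of `F3Bounds.boundH5` (tables `U_{3,l}, U_{2,l}`).
[cite: FitznerVanDerHofstad2016NoBLE, §3.3.5 (3.79), (3.84)–(3.86), PTRF pp. 1078–1079] -/
theorem abs_H5_le :
    |a.H5| ≤ 2 * r.Kunderline ^ 2 * r.Gamma2dash * (2 * r.afmax * r.bRfDelta + r.bRfDelta ^ 2) *
        (a.Dsin * (1 / (1 - a.D)) ^ 3) +
      2 * r.Kunderline ^ 2 * (r.afmax * r.bRpDelta + (r.ap + r.bRpDelta) * r.bRfDelta) *
        (a.Dsin * (1 / (1 - a.D)) ^ 2) := by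
  set C := 1 / (1 - a.D) with hCdef
  set K := r.Kunderline with hKdef
  have hC : 0 < C := h.C_pos
  have hK : 0 ≤ K := h.K_nn
  have hQ : 0 < a.Q := h.Q_pos
  have hbF : 0 ≤ r.bRfDelta := h.bRfDelta_nn
  have hbΦ : 0 ≤ r.bRpDelta := h.bRpDelta_nn
  have hΓ : 0 ≤ r.Gamma2dash := h.Gamma2dash_nn
  have hap : 0 ≤ r.ap := h.ap_nn
  have hDs : 0 ≤ a.Dsin := h.Dsin_nn
  have hαF : 0 < a.αF := h.αF_pos
  have hafmax : 0 ≤ r.afmax := hαF.le.trans h.αF_le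
  have hQ2 : 1 / a.Q ^ 2 ≤ (K * C) ^ 2 := h.inv_Q_sq_le
  -- `|Ĥ₅| ≤ 2 (|SFF| + 2 α_F |SDF|) (1/Q²) |Ĝ| + 2 (1/Q²) (α_F |SDΦ| + |α_Φ| |SDF| + |SΦF|)`
  have hH5 : |a.H5| ≤ 2 * ((|a.SFF| + 2 * a.αF * |a.SDF|) * (1 / a.Q ^ 2)) * |a.G| +
      2 * (1 / a.Q ^ 2) * (a.αF * |a.SDΦ| + |a.αΦ| * |a.SDF| + |a.SΦF|) := by
    rw [H5]
    refine (abs_sub _ _).trans (add_le_add ?_ ?_)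
    · rw [abs_mul, abs_mul, abs_neg, abs_two, abs_div, abs_of_pos (pow_pos hQ 2),
        div_eq_mul_one_div |a.SFF + 2 * a.αF * a.SDF| (a.Q ^ 2)]
      refine mul_le_mul_of_nonneg_right (mul_le_mul_of_nonneg_left (mul_le_mul_of_nonneg_right
        ((abs_add_le _ _).trans (add_le_add le_rfl (le_of_eq ?_))) (by positivity)) two_pos.le) (abs_nonneg _)
      rw [abs_mul, abs_mul, abs_two, abs_of_pos hαF]
    · rw [abs_mul, abs_div, abs_two, abs_of_pos (pow_pos hQ 2), div_eq_mul_one_div (2:ℝ) (a.Q ^ 2)]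
      refine mul_le_mul_of_nonneg_left ((abs_add_le _ _).trans (add_le_add ((abs_add_le _ _).trans
        (add_le_add (le_of_eq ?_) (le_of_eq ?_))) le_rfl)) (by positivity)
      · rw [abs_mul, abs_of_pos hαF]
      · rw [abs_mul]
  refine hH5.trans ?_
  have j1 : |a.SFF| + 2 * a.αF * |a.SDF| ≤ a.Dsin * r.bRfDelta ^ 2 + 2 * r.afmax * (a.Dsin * r.bRfDelta) :=
    add_le_add h.SFF_abs (mul_le_mul (mul_le_mul_of_nonneg_left h.αF_le two_pos.le) h.SDF_abs
      (abs_nonneg _) (by positivity))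
  have j2 : a.αF * |a.SDΦ| + |a.αΦ| * |a.SDF| + |a.SΦF| ≤
      r.afmax * (a.Dsin * r.bRpDelta) + r.ap * (a.Dsin * r.bRfDelta) + a.Dsin * r.bRpDelta * r.bRfDelta :=
    add_le_add (add_le_add (mul_le_mul h.αF_le h.SDΦ_abs (abs_nonneg _) hafmax)
      (mul_le_mul h.αΦ_abs h.SDF_abs (abs_nonneg _) hap)) h.SΦF_abs
  have n1 : 0 ≤ a.Dsin * r.bRfDelta ^ 2 + 2 * r.afmax * (a.Dsin * r.bRfDelta) := by positivity
  have n2 : 0 ≤ r.afmax * (a.Dsin * r.bRpDelta) + r.ap * (a.Dsin * r.bRfDelta) + a.Dsin * r.bRpDelta * r.bRfDelta := by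
    positivity
  calc 2 * ((|a.SFF| + 2 * a.αF * |a.SDF|) * (1 / a.Q ^ 2)) * |a.G| +
        2 * (1 / a.Q ^ 2) * (a.αF * |a.SDΦ| + |a.αΦ| * |a.SDF| + |a.SΦF|)
      ≤ 2 * ((a.Dsin * r.bRfDelta ^ 2 + 2 * r.afmax * (a.Dsin * r.bRfDelta)) * (K * C) ^ 2) *
          (r.Gamma2dash * C) +
        2 * (K * C) ^ 2 * (r.afmax * (a.Dsin * r.bRpDelta) + r.ap * (a.Dsin * r.bRfDelta) +
          a.Dsin * r.bRpDelta * r.bRfDelta) :=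
        add_le_add
          (mul_le_mul (mul_le_mul_of_nonneg_left (mul_le_mul j1 hQ2 (by positivity) n1) two_pos.le)
            h.abs_G_le (abs_nonneg _) (by positivity))
          (mul_le_mul (mul_le_mul_of_nonneg_left hQ2 two_pos.le) j2 (by positivity) (by positivity))
    _ = _ := by ring

end KeyBounds

end LapAtoms

/-! ## Function level: Fourier-analytic bounds on the remainder atoms -/

section FunctionLevel

variable {f g : Site d → ℝ}

/-- Total reflection symmetry passes to `|f|`. [folklore] -/
theorem IsTRS.abs (hT : IsTRS f) : IsTRS fun x => |f x| := fun ν δ x => by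
  show |f (siteSymm ν δ x)| = |f x|
  rw [hT ν δ x]

/-- `Σ_x ‖x‖₂² |f(x)| ≥ 0`. [folklore] -/
theorem tsum_normSq_mul_abs_nonneg (f : Site d → ℝ) : 0 ≤ ∑' x, normSq x * |f x| :=
  tsum_nonneg fun x => mul_nonneg (normSq_nonneg x) (abs_nonneg _)

/-- (3.49): `|Δ R̂(k)| = |Σ_x ‖x‖₂² cos(k·x) R(x)| ≤ Σ_x ‖x‖₂² |R(x)|`.
[cite: FitznerVanDerHofstad2016NoBLE, §3.3.4 (3.49), PTRF p. 1073] -/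
theorem abs_lapFT_le (h2 : Summable fun x => normSq x * |f x|) (k : Fin d → ℝ) :
    |lapFT f k| ≤ ∑' x, normSq x * |f x| := by
  rw [lapFT]
  refine (abs_cosFT_le (summable_mulNormSq_of_abs h2) k).trans (le_of_eq (tsum_congr fun x => ?_))
  rw [mulNormSq_apply, abs_mul, abs_of_nonneg (normSq_nonneg x)]

/-- (3.48): for a summable, totally reflection symmetric `R` with `Σ‖x‖₂²|R(x)| < ∞`,
`|R̂(0) − R̂(k)| ≤ Σ_x [1 − cos(k·x)] |R(x)| ≤ [1 − D̂(k)] Σ_x ‖x‖₂² |R(x)|` (the second step is [NoBLE17] Lemma 2.12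
applied to `|R|`). [cite: FitznerVanDerHofstad2016NoBLE, §3.3.4 (3.48), PTRF p. 1073; Lemma 2.12 (2.23), p. 1063] -/
theorem abs_cosFT_zero_sub_le_of_isTRS (hT : IsTRS f) (hf : Summable f)
    (h2 : Summable fun x => normSq x * |f x|) (k : Fin d → ℝ) :
    |cosFT f 0 - cosFT f k| ≤ (1 - Dhat d k) * ∑' x, normSq x * |f x| := by
  rw [cosFT_zero_sub_eq_tsum hf]
  have hc : ∀ x : Site d, |1 - Real.cos (kdot k x)| ≤ 1 - Real.cos (kdot k x) := fun x =>
    (abs_of_nonneg (sub_nonneg.2 (Real.cos_le_one _))).le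
  have hs1 : Summable fun x => (1 - Real.cos (kdot k x)) * f x :=
    (hf.sub (summable_cos_kdot_mul hf k)).congr fun x => by ring
  have hs2 : Summable fun x => (1 - Real.cos (kdot k x)) * |f x| :=
    (hf.abs.sub (summable_cos_kdot_mul hf.abs k)).congr fun x => by ring
  refine (abs_tsum_mul_le hc hs1 hs2).trans ?_
  have h2' : Summable fun x => euclidNorm x ^ 2 * |f x| :=
    h2.congr fun x => by rw [euclidNorm_sq, normSq]
  have h := tsum_mul_one_sub_cos_kdot_le_of_isTRS hf.abs (fun x => abs_nonneg _) h2' hT.abs k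
  calc ∑' x, (1 - Real.cos (kdot k x)) * |f x| = ∑' x, |f x| * (1 - Real.cos (kdot k x)) :=
        tsum_congr fun x => mul_comm _ _
    _ ≤ (1 - Dhat d k) * ∑' x, euclidNorm x ^ 2 * |f x| := h
    _ = (1 - Dhat d k) * ∑' x, normSq x * |f x| := by
        congr 1; exact tsum_congr fun x => by rw [euclidNorm_sq, normSq]

/-! ### The gradient bound (3.80)–(3.82) via one partial reflection -/

/-- The reflection of every coordinate except `s` (`p(x; id, δ)` of Def. 2.5 with `δ_j = +1` iff `j = s`).
[cite: FitznerVanDerHofstad2016NoBLE, Def. 2.5 (p. 1058)] -/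
def flipExcept (s : Fin d) : Site d → Site d := siteSymm (Equiv.refl (Fin d)) (fun j => decide (j = s))

/-- Coordinates of `flipExcept s x`. [folklore] -/
theorem flipExcept_apply (s : Fin d) (x : Site d) (j : Fin d) :
    flipExcept s x j = if j = s then x j else -x j := by
  unfold flipExcept siteSymm
  by_cases h : j = s <;> simp [h]

/-- `flipExcept s` is an involution. [folklore] -/
theorem flipExcept_flipExcept (s : Fin d) (x : Site d) : flipExcept s (flipExcept s x) = x := by
  ext j; by_cases h : j = s <;> simp [flipExcept_apply, h]

/-- `k·x̃ = 2 k_s x_s − k·x` for `x̃ = flipExcept s x`. [folklore] -/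
theorem kdot_flipExcept (s : Fin d) (k : Fin d → ℝ) (x : Site d) :
    kdot k (flipExcept s x) = 2 * (k s * x s) - kdot k x := by
  have hk : ∀ y : Site d, kdot k y = ∑ j, k j * (y j : ℝ) := fun y => rfl
  have hsum : kdot k (flipExcept s x) + kdot k x = 2 * (k s * x s) := by
    rw [hk, hk, ← Finset.sum_add_distrib, Finset.sum_eq_single s]
    · simp [flipExcept_apply]; ring
    · intro j _ hj; simp [flipExcept_apply, hj]
    · intro h; exact absurd (Finset.mem_univ s) h
  linarith

/-- A totally reflection symmetric function is invariant under `flipExcept s`. [folklore] -/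
theorem IsTRS.flipExcept (hT : IsTRS f) (s : Fin d) (x : Site d) : f (flipExcept s x) = f x := hT _ _ x

/-- (3.80)–(3.81) in derivative-free form: for totally reflection symmetric `f`,
`Σ_x sin(k·x) x_s f(x) = Σ_x sin(k_s x_s) cos(k·x − k_s x_s) x_s f(x)` (symmetrisation over the reflection of
the coordinates `ν ≠ s`). [cite: FitznerVanDerHofstad2016NoBLE, §3.3.5 (3.80)–(3.81), PTRF p. 1078] -/
theorem gradFT_eq_tsum_of_isTRS (hT : IsTRS f) {s : Fin d} (hs : Summable (mulCoord s f)) (k : Fin d → ℝ) :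
    gradFT s f k = ∑' x, Real.sin (k s * x s) * Real.cos (kdot k x - k s * x s) * mulCoord s f x := by
  have hinv : Function.Involutive (flipExcept (d := d) s) := flipExcept_flipExcept s
  set e : Site d ≃ Site d := hinv.toPerm _ with he
  have hea : ∀ x, e x = flipExcept s x := fun x => rfl
  set G : Site d → ℝ := fun x => Real.sin (kdot k x) * mulCoord s f x with hG
  have hGs : Summable G := Summable.of_norm_bounded hs.abs fun x => by
    rw [Real.norm_eq_abs, hG, abs_mul]
    exact mul_le_of_le_one_left (abs_nonneg _) (Real.abs_sin_le_one _)
  have hm : ∀ x, mulCoord s f (flipExcept s x) = mulCoord s f x := fun x => by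
    rw [mulCoord_apply, mulCoord_apply, hT.flipExcept, flipExcept_apply, if_pos rfl]
  have h1 : ∑' x, G x = ∑' x, G (e x) := (Equiv.tsum_eq e G).symm
  have h2 : ∀ x, G (e x) = Real.sin (2 * (k s * x s) - kdot k x) * mulCoord s f x := fun x => by
    simp only [hG, hea, kdot_flipExcept, hm]
  have hGs' : Summable fun x => G (e x) := (Equiv.summable_iff e).2 hGs
  have h3 : ∑' x, G x = (∑' x, (G x + G (e x))) / 2 := by
    rw [hGs.tsum_add hGs', ← h1]; ring
  rw [gradFT, sinFT, show (∑' x, Real.sin (kdot k x) * mulCoord s f x) = ∑' x, G x from rfl, h3,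
    div_eq_iff (two_ne_zero), ← tsum_mul_right]
  refine tsum_congr fun x => ?_
  rw [h2, hG]
  have trig : Real.sin (kdot k x) + Real.sin (2 * (k s * x s) - kdot k x) =
      2 * Real.sin (k s * x s) * Real.cos (kdot k x - k s * x s) := by
    obtain ⟨t, ht⟩ : ∃ t : ℝ, kdot k x = k s * x s + t := ⟨kdot k x - k s * x s, by ring⟩
    rw [ht]
    have eB : 2 * (k s * ↑(x s)) - (k s * ↑(x s) + t) = k s * x s - t := by ring
    have eC : k s * ↑(x s) + t - k s * ↑(x s) = t := by ring
    rw [eB, eC, Real.sin_add, Real.sin_sub]; ring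
  calc Real.sin (kdot k x) * mulCoord s f x + Real.sin (2 * (k s * x s) - kdot k x) * mulCoord s f x
      = (Real.sin (kdot k x) + Real.sin (2 * (k s * x s) - kdot k x)) * mulCoord s f x := by ring
    _ = _ := by rw [trig]; ring

/-- `|sin(n t)| ≤ |n| |sin t|` for `n ∈ ℤ`. [folklore] -/
theorem abs_sin_int_mul_le (n : ℤ) (t : ℝ) : |Real.sin (n * t)| ≤ |(n : ℝ)| * |Real.sin t| := by
  have key : ∀ (m : ℕ) (u : ℝ), |Real.sin (m * u)| ≤ m * |Real.sin u| := by
    intro m u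
    induction m with
    | zero => simp
    | succ m ih =>
      have h1 : Real.sin ((m + 1 : ℕ) * u) = Real.sin (m * u) * Real.cos u + Real.cos (m * u) * Real.sin u := by
        rw [Nat.cast_succ, add_mul, one_mul, Real.sin_add]
      rw [h1, Nat.cast_succ]
      calc |Real.sin (m * u) * Real.cos u + Real.cos (m * u) * Real.sin u|
          ≤ |Real.sin (m * u) * Real.cos u| + |Real.cos (m * u) * Real.sin u| := abs_add_le _ _
        _ = |Real.sin (m * u)| * |Real.cos u| + |Real.cos (m * u)| * |Real.sin u| := by rw [abs_mul, abs_mul]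
        _ ≤ |Real.sin (m * u)| * 1 + 1 * |Real.sin u| :=
            add_le_add (mul_le_mul_of_nonneg_left (Real.abs_cos_le_one u) (abs_nonneg _))
              (mul_le_mul_of_nonneg_right (Real.abs_cos_le_one _) (abs_nonneg _))
        _ ≤ m * |Real.sin u| + |Real.sin u| := by linarith
        _ = (m + 1) * |Real.sin u| := by ring
  obtain ⟨m, hm | hm⟩ := n.eq_nat_or_neg
  · subst hm; rw [Int.cast_natCast, Nat.abs_cast]; exact key m t
  · subst hm
    rw [Int.cast_neg, Int.cast_natCast, neg_mul, Real.sin_neg, abs_neg, abs_neg, Nat.abs_cast]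
    exact key m t

/-- (3.82) in derivative-free form: `|Σ_x sin(k·x) x_s f(x)| ≤ |sin k_s| Σ_x x_s² |f(x)|` for totally reflection
symmetric `f` (uses `|sin(k_s x_s)| ≤ |x_s| |sin k_s|`).
[cite: FitznerVanDerHofstad2016NoBLE, §3.3.5 (3.80)–(3.82), PTRF p. 1078] -/
theorem abs_gradFT_le_of_isTRS (hT : IsTRS f) (hf : Summable f) (h2 : Summable fun x => normSq x * |f x|)
    (s : Fin d) (k : Fin d → ℝ) :
    |gradFT s f k| ≤ |Real.sin (k s)| * ∑' x, ((x s : ℤ) : ℝ) ^ 2 * |f x| := by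
  have hs : Summable (mulCoord s f) := summable_mulCoord hf (summable_mulNormSq_of_abs h2) s
  have hsq : Summable fun x => ((x s : ℤ) : ℝ) ^ 2 * |f x| :=
    summable_sq_coord_mul (g := fun x => |f x|) (fun x => abs_nonneg _)
      (h2.congr fun x => by rw [euclidNorm_sq, normSq]) s
  rw [gradFT_eq_tsum_of_isTRS hT hs k]
  have key : ∀ x : Site d, |Real.sin (k s * x s) * Real.cos (kdot k x - k s * x s)| ≤
      |((x s : ℤ) : ℝ)| * |Real.sin (k s)| := by
    intro x
    rw [abs_mul]
    calc |Real.sin (k s * x s)| * |Real.cos (kdot k x - k s * x s)| ≤ |Real.sin (k s * x s)| * 1 :=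
          mul_le_mul_of_nonneg_left (Real.abs_cos_le_one _) (abs_nonneg _)
      _ = |Real.sin ((x s : ℝ) * k s)| := by rw [mul_one, mul_comm]
      _ ≤ |((x s : ℤ) : ℝ)| * |Real.sin (k s)| := abs_sin_int_mul_le (x s) (k s)
  have hS1 : Summable fun x => Real.sin (k s * x s) * Real.cos (kdot k x - k s * x s) * mulCoord s f x :=
    Summable.of_norm_bounded hs.abs fun x => by
      rw [Real.norm_eq_abs, abs_mul]
      refine mul_le_of_le_one_left (abs_nonneg _) ?_
      rw [abs_mul]
      exact mul_le_one₀ (Real.abs_sin_le_one _) (abs_nonneg _) (Real.abs_cos_le_one _)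
  have hS2 : Summable fun x => |((x s : ℤ) : ℝ)| * |Real.sin (k s)| * |mulCoord s f x| :=
    (hsq.mul_left |Real.sin (k s)|).congr fun x => by
      rw [mulCoord_apply, abs_mul, pow_two]
      rw [← abs_mul_abs_self ((x s : ℤ) : ℝ)]; ring
  refine (abs_tsum_mul_le key hS1 hS2).trans (le_of_eq ?_)
  rw [← tsum_mul_left]
  refine tsum_congr fun x => ?_
  rw [mulCoord_apply, abs_mul, pow_two, ← abs_mul_abs_self ((x s : ℤ) : ℝ)]; ring

/-- (3.83): isotropy, `Σ_x x_s² |f(x)| = (1/d) Σ_x ‖x‖₂² |f(x)|` for totally reflection symmetric `f`.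
[cite: FitznerVanDerHofstad2016NoBLE, §3.3.5 (3.83), PTRF p. 1078] -/
theorem tsum_sq_coord_mul_abs_eq_of_isTRS (hT : IsTRS f) (h2 : Summable fun x => normSq x * |f x|)
    (s : Fin d) : ∑' x, ((x s : ℤ) : ℝ) ^ 2 * |f x| = (∑' x, normSq x * |f x|) / d := by
  have hsym : IsZdSymmetric (fun x => |f x|) := hT.abs.isZdSymmetric
  have habs : Summable fun x => euclidNorm x ^ 2 * |(fun x => |f x|) x| := by
    refine h2.congr fun x => ?_
    simp only [abs_abs]
    rw [euclidNorm_sq, normSq]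
  rw [tsum_sq_apply_mul_eq hsym habs s]
  congr 1
  exact tsum_congr fun x => by rw [euclidNorm_sq, normSq]

/-- (3.82)–(3.83): `|Σ_x sin(k·x) x_s f(x)| ≤ |sin k_s| (1/d) Σ_x ‖x‖₂² |f(x)|`.
[cite: FitznerVanDerHofstad2016NoBLE, §3.3.5 (3.82)–(3.83), PTRF p. 1078] -/
theorem abs_gradFT_le_of_isTRS' (hT : IsTRS f) (hf : Summable f) (h2 : Summable fun x => normSq x * |f x|)
    (s : Fin d) (k : Fin d → ℝ) :
    |gradFT s f k| ≤ |Real.sin (k s)| * ((∑' x, normSq x * |f x|) / d) := by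
  rw [← tsum_sq_coord_mul_abs_eq_of_isTRS hT h2 s]; exact abs_gradFT_le_of_isTRS hT hf h2 s k

/-- (3.84), derivative-free: `Σ_s |∂_s f̂(k) ∂_s ĝ(k)| ≤ D̂^{sin}(k) Σ_x‖x‖₂²|f(x)| Σ_y‖y‖₂²|g(y)|`.
[cite: FitznerVanDerHofstad2016NoBLE, §3.3.5 (3.84), PTRF p. 1078] -/
theorem sum_abs_gradFT_mul_gradFT_le (hTf : IsTRS f) (hf : Summable f)
    (hf2 : Summable fun x => normSq x * |f x|) (hTg : IsTRS g) (hg : Summable g)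
    (hg2 : Summable fun x => normSq x * |g x|) (k : Fin d → ℝ) :
    ∑ s, |gradFT s f k * gradFT s g k| ≤
      Dsin d k * (∑' x, normSq x * |f x|) * ∑' x, normSq x * |g x| := by
  have hWf : 0 ≤ ∑' x, normSq x * |f x| := tsum_normSq_mul_abs_nonneg f
  have hWg : 0 ≤ ∑' x, normSq x * |g x| := tsum_normSq_mul_abs_nonneg g
  set Wf := ∑' x, normSq x * |f x|
  set Wg := ∑' x, normSq x * |g x|
  calc ∑ s, |gradFT s f k * gradFT s g k| = ∑ s, |gradFT s f k| * |gradFT s g k| := by simp_rw [abs_mul]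
    _ ≤ ∑ s, |Real.sin (k s)| * (Wf / d) * (|Real.sin (k s)| * (Wg / d)) :=
        Finset.sum_le_sum fun s _ => mul_le_mul (abs_gradFT_le_of_isTRS' hTf hf hf2 s k)
          (abs_gradFT_le_of_isTRS' hTg hg hg2 s k) (abs_nonneg _) (by positivity)
    _ = Dsin d k * Wf * Wg := by
        rw [Dsin]
        have e : ∀ s, |Real.sin (k s)| * (Wf / d) * (|Real.sin (k s)| * (Wg / d)) =
            Real.sin (k s) ^ 2 * (Wf * Wg / (d : ℝ) ^ 2) := fun s => by
          rw [pow_two, ← abs_mul_abs_self (Real.sin (k s))]; ring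
        simp_rw [e]
        rw [← Finset.sum_mul]; ring

/-- `|Σ_s (sin k_s/d) ∂_s f̂(k)| ≤ D̂^{sin}(k) Σ_x ‖x‖₂² |f(x)|` (the `∂_sD̂ ∂_sR̂` terms of `Ĥ₅`).
[cite: FitznerVanDerHofstad2016NoBLE, §3.3.5 (3.79), (3.82)–(3.84), PTRF p. 1078] -/
theorem abs_sum_sin_div_mul_gradFT_le (hT : IsTRS f) (hf : Summable f)
    (h2 : Summable fun x => normSq x * |f x|) (k : Fin d → ℝ) :
    |∑ s, Real.sin (k s) / d * gradFT s f k| ≤ Dsin d k * ∑' x, normSq x * |f x| := by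
  set W := ∑' x, normSq x * |f x|
  refine (Finset.abs_sum_le_sum_abs _ _).trans ?_
  calc ∑ s, |Real.sin (k s) / d * gradFT s f k| = ∑ s, |Real.sin (k s)| / d * |gradFT s f k| := by
        refine Finset.sum_congr rfl fun s _ => ?_
        rw [abs_mul, abs_div, Nat.abs_cast]
    _ ≤ ∑ s, |Real.sin (k s)| / d * (|Real.sin (k s)| * (W / d)) :=
        Finset.sum_le_sum fun s _ => mul_le_mul_of_nonneg_left (abs_gradFT_le_of_isTRS' hT hf h2 s k)
          (by positivity)
    _ = Dsin d k * W := by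
        rw [Dsin]
        have e : ∀ s, |Real.sin (k s)| / d * (|Real.sin (k s)| * (W / d)) =
            Real.sin (k s) ^ 2 * (W / (d : ℝ) ^ 2) := fun s => by
          rw [pow_two, ← abs_mul_abs_self (Real.sin (k s))]; ring
        simp_rw [e]
        rw [← Finset.sum_mul]; ring

/-- `Σ_s (∂_s f̂(k))² ≤ D̂^{sin}(k) (Σ_x ‖x‖₂² |f(x)|)²`.
[cite: FitznerVanDerHofstad2016NoBLE, §3.3.5 (3.84), PTRF p. 1078] -/
theorem sum_gradFT_sq_le (hT : IsTRS f) (hf : Summable f) (h2 : Summable fun x => normSq x * |f x|)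
    (k : Fin d → ℝ) : ∑ s, gradFT s f k ^ 2 ≤ Dsin d k * (∑' x, normSq x * |f x|) ^ 2 := by
  set W := ∑' x, normSq x * |f x|
  calc ∑ s, gradFT s f k ^ 2 = ∑ s, |gradFT s f k| ^ 2 := by simp_rw [sq_abs]
    _ ≤ ∑ s, (|Real.sin (k s)| * (W / d)) ^ 2 :=
        Finset.sum_le_sum fun s _ => pow_le_pow_left₀ (abs_nonneg _) (abs_gradFT_le_of_isTRS' hT hf h2 s k) 2
    _ = Dsin d k * W ^ 2 := by
        rw [Dsin]
        have e : ∀ s, (|Real.sin (k s)| * (W / d)) ^ 2 = Real.sin (k s) ^ 2 * (W ^ 2 / (d : ℝ) ^ 2) :=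
          fun s => by rw [mul_pow, sq_abs]; ring
        simp_rw [e]
        rw [← Finset.sum_mul]; ring

/-! ### (3.47) from the bootstrap hypothesis `f₂(p) ≤ Γ₂` -/

/-- (3.47): `[1 − D̂(k)] |τ̂_p(k)| ≤ Γ₂′ = ((2d−2)/(2d−1)) Γ₂` on the cube, from `f₂(p) ≤ Γ₂` (`d ≥ 2`, `τ_p` summable).
[cite: FitznerVanDerHofstad2016NoBLE, §3.3.4 (3.47), PTRF p. 1073; (2.6), p. 1056] -/
theorem oneSubDhat_mul_abs_tauHat_le_of_nobleF2_le (hd : 2 ≤ d) (p : unitInterval)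
    (hs : Summable fun x => tau d p 0 x) {Γ₂ : ℝ} (hΓ : nobleF2 d p ≤ Γ₂) {k : Fin d → ℝ} (hk : k ∈ cube d) :
    (1 - Dhat d k) * |tauHat d p k| ≤ (2 * d - 2) / (2 * d - 1) * Γ₂ :=
  (le_ciSup (bddAbove_nobleSup2 p hs) (⟨k, hk⟩ : cube d)).trans (nobleSup2_le_of_nobleF2_le hd p hΓ)

end FunctionLevel

/-! ## Assembling `KeyBounds` for the atoms of a symmetric simplified rewrite -/

section Assemble

variable {cΦ αΦ cF αF : ℝ} {RΦ RF : Site d → ℝ}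

/-- `F̂(0) = 2dλ/(1 + λ) < 1` when `0 ≤ λ` and `(2d − 1)λ < 1` (the `λ_z` conjuncts of the L0 interface).
[cite: FitznerVanDerHofstad2016NoBLE, §3.3.4, the display `F̂_z(0) = 2dλ_z/(1+λ_z)` before (3.41), PTRF p. 1072] -/
theorem F0_lt_one_of_lam {lam : ℝ} (hF0 : cF + αF + cosFT RF 0 = 2 * d * lam / (1 + lam))
    (hlam0 : 0 ≤ lam) (hlam1 : (2 * d - 1) * lam < 1) : cF + αF + cosFT RF 0 < 1 := by
  rw [hF0, div_lt_one (by linarith)]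
  linarith

/-- **The key bounds hold for a symmetric simplified rewrite.**  Let `(c_Φ, α_Φ, c_F, α_F, R_Φ, R_F)` satisfy the
simplified rewrite `τ̂_p(k)[1 − F̂(k)] = Φ̂(k)` on the cube with `F̂(0) < 1`, the bounds `0 ≤ c_Φ ≤ c̄_Φ`,
`|α_Φ| ≤ β_{α,Φ}`, `α̲_F ≤ α_F ≤ ᾱ_F`, `Σ|R_Φ| ≤ β_{R,Φ}`, `Σ‖x‖²|R_Φ| ≤ β_{ΔR,Φ}`, `Σ‖x‖²|R_F| ≤ β_{|ΔR,F|}`,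
`−β_Δ[1 − D̂] ≤ δ_{R,F}` on the cube, with `R_Φ, R_F` totally reflection symmetric, `0 < α̲_F`, `β_Δ < α̲_F`,
`p < p_c`, `d ≥ 2` and `f₂(p) ≤ Γ₂`.  Then at every `k` of the cube with `D̂(k) < 1` the atoms
`lapAtomsAt d c_Φ α_Φ c_F α_F R_Φ R_F k` satisfy `KeyBounds` with the arguments `NobleBetaF3.toArgs d B E Γ₂`.
[cite: FitznerVanDerHofstad2016NoBLE, §3.3.4 (3.40)–(3.51), PTRF pp. 1072–1073; §3.3.5 (3.80)–(3.84), p. 1078] -/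
theorem keyBounds_lapAtomsAt (hd : 2 ≤ d) {p : unitInterval}
    (hp : (p : ℝ) < criticalProb (zdGraph d) (0 : Site d)) {B : NobleBeta} {E : NobleBetaF3} {Γ₂ : ℝ}
    (hΓ : nobleF2 d p ≤ Γ₂)
    (hRΦ : Summable RΦ) (hRF : Summable RF) (hTΦ : IsTRS RΦ) (hTF : IsTRS RF)
    (hform : ∀ k ∈ cube d, tauHat d p k * (1 - (cF + αF * Dhat d k + cosFT RF k)) =
      cΦ + αΦ * Dhat d k + cosFT RΦ k)
    (hF0 : cF + αF + cosFT RF 0 < 1)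
    (hcΦ0 : 0 ≤ cΦ) (hcΦ : cΦ ≤ B.cΦup) (hαΦ : |αΦ| ≤ B.βαΦ) (hαF : B.αFlow ≤ αF) (hαFup : αF ≤ E.αFup)
    (hRΦle : ∑' x, |RΦ x| ≤ B.βRΦ)
    (hsΦ : Summable fun x => normSq x * |RΦ x|) (hΔΦ : ∑' x, normSq x * |RΦ x| ≤ E.βΔRΦ)
    (hsF : Summable fun x => normSq x * |RF x|) (hΔF : ∑' x, normSq x * |RF x| ≤ E.βΔRFabs)
    (hRFb : ∀ k ∈ cube d, -(B.βΔ * (1 - Dhat d k)) ≤ cosFT RF 0 - cosFT RF k)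
    (hαFlow : 0 < B.αFlow) (hgap : B.βΔ < B.αFlow)
    {k : Fin d → ℝ} (hk : k ∈ cube d) (hD : Dhat d k < 1) :
    (lapAtomsAt d cΦ αΦ cF αF RΦ RF k).KeyBounds (NobleBetaF3.toArgs d B E Γ₂) := by
  have hτ : Summable fun x => tau d p 0 x := summable_tau_of_lt_criticalProb hd p hp
  have h1D : 0 < 1 - Dhat d k := sub_pos.2 hD
  have hWΦ : 0 ≤ ∑' x, normSq x * |RΦ x| := tsum_normSq_mul_abs_nonneg RΦ
  have hWF : 0 ≤ ∑' x, normSq x * |RF x| := tsum_normSq_mul_abs_nonneg RF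
  have hDs : 0 ≤ Dsin d k := Dsin_nonneg k
  -- the denominator `Q = 1 − F̂(k)` and its lower bound (3.46)
  have hCden : (lapAtomsAt d cΦ αΦ cF αF RΦ RF k).Cden = 1 - (cF + αF + cosFT RF 0) + αF * (1 - Dhat d k) :=
    lapAtomsAt_Cden
  have hQeq : (lapAtomsAt d cΦ αΦ cF αF RΦ RF k).Q =
      1 - (cF + αF + cosFT RF 0) + αF * (1 - Dhat d k) + (cosFT RF 0 - cosFT RF k) := by
    rw [lapAtomsAt_Q]; ring
  have hQge : (B.αFlow - B.βΔ) * (1 - Dhat d k) ≤ (lapAtomsAt d cΦ αΦ cF αF RΦ RF k).Q := by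
    rw [hQeq]
    have := hRFb k hk
    nlinarith [mul_le_mul_of_nonneg_right hαF h1D.le]
  have hQpos : 0 < (lapAtomsAt d cΦ αΦ cF αF RΦ RF k).Q :=
    (mul_pos (sub_pos.2 hgap) h1D).trans_le hQge
  have hG : (lapAtomsAt d cΦ αΦ cF αF RΦ RF k).G = tauHat d p k := by
    rw [LapAtoms.G, LapAtoms.Phi, div_eq_iff hQpos.ne']
    simpa using (hform k hk).symm
  have hgradΦ := abs_sum_sin_div_mul_gradFT_le hTΦ hRΦ hsΦ k
  have hgradF := abs_sum_sin_div_mul_gradFT_le hTF hRF hsF k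
  refine
    { D_lt := hD
      absD := abs_Dhat_le_one k
      Dsin_nn := hDs
      Q_pos := hQpos
      Q_ge := ?_
      K_nn := ?_
      Cden_ge := ?_
      afmin_pos := hαFlow
      αF_ge := hαF
      αF_le := hαFup
      δ_abs := ?_
      cΦ_nn := hcΦ0
      cΦ_le := hcΦ
      αΦ_abs := hαΦ
      RΦ_abs := (abs_cosFT_le hRΦ k).trans hRΦle
      LΦ_abs := (abs_lapFT_le hsΦ k).trans hΔΦ
      LF_abs := (abs_lapFT_le hsF k).trans hΔF
      SDΦ_abs := ?_
      SDF_abs := ?_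
      SΦF_abs := ?_
      SFF_abs := ?_
      G_abs := ?_ }
  · -- (3.46): `1 − D̂ ≤ K̲ Q`, `K̲ = 1/(α̲_F − β_Δ)`
    show 1 - Dhat d k ≤ 1 / (B.αFlow - B.βΔ) * (lapAtomsAt d cΦ αΦ cF αF RΦ RF k).Q
    rw [one_div_mul_eq_div, le_div_iff₀ (sub_pos.2 hgap)]
    linarith
  · show 0 ≤ 1 / (B.αFlow - B.βΔ)
    exact (one_div_pos.2 (sub_pos.2 hgap)).le
  · show αF * (1 - Dhat d k) ≤ (lapAtomsAt d cΦ αΦ cF αF RΦ RF k).Cden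
    rw [hCden]; linarith
  · show |cosFT RF 0 - cosFT RF k| ≤ (1 - Dhat d k) * E.βΔRFabs
    exact (abs_cosFT_zero_sub_le_of_isTRS hTF hRF hsF k).trans (mul_le_mul_of_nonneg_left hΔF h1D.le)
  · show |∑ s, Real.sin (k s) / d * gradFT s RΦ k| ≤ Dsin d k * E.βΔRΦ
    exact hgradΦ.trans (mul_le_mul_of_nonneg_left hΔΦ hDs)
  · show |∑ s, Real.sin (k s) / d * gradFT s RF k| ≤ Dsin d k * E.βΔRFabs
    exact hgradF.trans (mul_le_mul_of_nonneg_left hΔF hDs)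
  · show |∑ s, gradFT s RΦ k * gradFT s RF k| ≤ Dsin d k * E.βΔRΦ * E.βΔRFabs
    refine (Finset.abs_sum_le_sum_abs _ _).trans ((sum_abs_gradFT_mul_gradFT_le hTΦ hRΦ hsΦ hTF hRF hsF k).trans ?_)
    exact mul_le_mul (mul_le_mul_of_nonneg_left hΔΦ hDs) hΔF hWF (mul_nonneg hDs ((hWΦ).trans hΔΦ))
  · show |∑ s, gradFT s RF k ^ 2| ≤ Dsin d k * E.βΔRFabs ^ 2
    rw [abs_of_nonneg (Finset.sum_nonneg fun s _ => sq_nonneg _)]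
    refine (sum_gradFT_sq_le hTF hRF hsF k).trans ?_
    exact mul_le_mul_of_nonneg_left (pow_le_pow_left₀ hWF hΔF 2) hDs
  · show (1 - Dhat d k) * |(lapAtomsAt d cΦ αΦ cF αF RΦ RF k).G| ≤ (2 * d - 2) / (2 * d - 1) * Γ₂
    rw [hG]; exact oneSubDhat_mul_abs_tauHat_le_of_nobleF2_le hd p hτ hΓ hk

/-- The same with the `λ_z` conjuncts of the L0 interface in place of `F̂(0) < 1`, and the consequence spelled
out: at every `k ∈ [−π,π]^d` with `D̂(k) < 1`, `τ̂_p(k) = Ĝ(k)`, `tauWHat d p k = Σ_i Ĥ_i(k)` and the pointwise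
bounds `abs_H2_le … abs_H5_le` apply with the arguments `NobleBetaF3.toArgs d B E Γ₂`.
[cite: FitznerVanDerHofstad2016NoBLE, §3.3.4 (3.40)–(3.57), PTRF pp. 1072–1074; §3.3.5 Steps 2–5, pp. 1077–1079] -/
theorem keyBounds_and_split (hd : 2 ≤ d) {p : unitInterval}
    (hp : (p : ℝ) < criticalProb (zdGraph d) (0 : Site d)) {B : NobleBeta} {E : NobleBetaF3} {Γ₂ : ℝ}
    (hΓ : nobleF2 d p ≤ Γ₂) {lam : ℝ}
    (hRΦ : Summable RΦ) (hRF : Summable RF) (hTΦ : IsTRS RΦ) (hTF : IsTRS RF)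
    (hform : ∀ k ∈ cube d, tauHat d p k * (1 - (cF + αF * Dhat d k + cosFT RF k)) =
      cΦ + αΦ * Dhat d k + cosFT RΦ k)
    (hF0 : cF + αF + cosFT RF 0 = 2 * d * lam / (1 + lam)) (hlam0 : 0 ≤ lam) (hlam1 : (2 * d - 1) * lam < 1)
    (hcΦ0 : 0 ≤ cΦ) (hcΦ : cΦ ≤ B.cΦup) (hαΦ : |αΦ| ≤ B.βαΦ) (hαF : B.αFlow ≤ αF) (hαFup : αF ≤ E.αFup)
    (hRΦle : ∑' x, |RΦ x| ≤ B.βRΦ)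
    (hsΦ : Summable fun x => normSq x * |RΦ x|) (hΔΦ : ∑' x, normSq x * |RΦ x| ≤ E.βΔRΦ)
    (hsF : Summable fun x => normSq x * |RF x|) (hΔF : ∑' x, normSq x * |RF x| ≤ E.βΔRFabs)
    (hRFb : ∀ k ∈ cube d, -(B.βΔ * (1 - Dhat d k)) ≤ cosFT RF 0 - cosFT RF k)
    (hαFlow : 0 < B.αFlow) (hgap : B.βΔ < B.αFlow)
    {k : Fin d → ℝ} (hk : k ∈ cube d) (hD : Dhat d k < 1) :
    (lapAtomsAt d cΦ αΦ cF αF RΦ RF k).KeyBounds (NobleBetaF3.toArgs d B E Γ₂) ∧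
      tauHat d p k = (lapAtomsAt d cΦ αΦ cF αF RΦ RF k).G ∧
      tauWHat d p k = (lapAtomsAt d cΦ αΦ cF αF RΦ RF k).H1 + (lapAtomsAt d cΦ αΦ cF αF RΦ RF k).H2 +
        (lapAtomsAt d cΦ αΦ cF αF RΦ RF k).H3 + (lapAtomsAt d cΦ αΦ cF αF RΦ RF k).H4 +
        (lapAtomsAt d cΦ αΦ cF αF RΦ RF k).H5 := by
  have hKB := keyBounds_lapAtomsAt hd hp hΓ hRΦ hRF hTΦ hTF hform (F0_lt_one_of_lam hF0 hlam0 hlam1) hcΦ0 hcΦ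
    hαΦ hαF hαFup hRΦle hsΦ hΔΦ hsF hΔF hRFb hαFlow hgap hk hD
  exact ⟨hKB, tauWHat_eq_sum_H hd p hp hRΦ hRF hsΦ hsF hform k hKB.Q_pos.ne' hKB.Cden_pos.ne'⟩

end Assemble

end Literature.Probability.FitznerVanDerHofstad2017
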